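import Summits.BirchSwinnertonDyer.Rank1Residual.SmallImageMu.GradedEulerLoss
import Summits.BirchSwinnertonDyer.Rank1Residual.X10.CoreTheoremAOddPrimeHolds
import Literature.NumberTheory.EllipticCurves.KatoFineSelmerDualGraded
import HarnessLib

/-!
# The GRADED DISCRETE CORE `FineCoreGradedOddPrime` and its kernel link to ES-C4
# (`SmallImageMu.FineExponentLeEulerLossOnClassX9`); the `n = 0` slices are theorems

Cell `bsd-f3-mu`, seat `-es` (planner-bsd-f3-mu-es-g4-0), HOME/es/Sketch5.lean Part 3 verbatim (HOME/MEMO-es.md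
§25).  One `@[conjecture] def` (OPEN for `n ≥ 1`, nothing asserted) + theorems.

`SmallImageMu.FineExponentLeEulerLossOnClassX9` (ES-C4) says `μ(p^n · X₀) = 0` from an Euler-system class
`s ∉ p^{n+1}𝐇¹`.  Its `n = 0` case is the kernel core theorem `X10.coreTheoremAOddPrime_holds`, whose
conclusion is DISCRETE («some `(conj_γ − 1)^J` kills every `y ∈ H¹(ℚ_∞, E[p])` whose image lies in
`Sel₀(ℚ_∞, E[p^∞])`»).  Here:

* `FineCoreGradedOddPrime` — the graded discrete core: the same with «image in `p^n · Sel₀`» and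
  «`s ∉ p^{n+1}𝐇¹`» (the statement a port of `CoreAssembly.coreOdd_of_selmerDual_of_stepsTwoFour` to the
  ring `Λ/(p^{n+1}, ω²)` must conclude); `core_of_fineCoreGraded` (its `n = 0` slice is
  `X10.CoreTheoremAOddPrime`); `fineCoreGraded_zero` (the `n = 0` slice is PROVED).
* `muInvariant_pPow_eq_zero_of_forall_iterate_eq_zero` — pointwise conversion (any number field): the
  discrete kill hypothesis ⟹ `μ(p^n · Y.X) = 0` (graded Kummer reduction + graded Pontryagin duality of
  `KatoFineSelmerDualGraded` + `lengthAt_eq_zero_of_finite_quotient_p`).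
* `fineExponentLeEulerLossOnClassX9_of_fineCoreGraded : FineCoreGradedOddPrime → ES-C4` (kernel) and
  `fineExponentLeEulerLossOnClassX9_zero` (the leaf's `n = 0` slice, PROVED).

HONEST FRAMING: BSD is not advanced; the `n ≥ 1` slices are open (MEMO-es §15/§25: stubs hG1ᵍ + S1 + S2).
-/

set_option linter.dupNamespace false

noncomputable section

open scoped Classical

/-! ## Part 3 — the graded discrete core and the kernel link to ES-C4 -/

open WeierstrassCurve Field Literature.NumberTheory.EllipticCurves
  Literature.NumberTheory.GaloisRepresentations
  Literature.NumberTheory.EllipticCurves.Kato2004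
  Literature.NumberTheory.EllipticCurves.Kato2004.EulerSystemValues
  Summit.BirchSwinnertonDyer.BirchSwinnertonDyer.Rank1Residual
  Summit.BirchSwinnertonDyer.Rank1Residual

namespace Summit.BirchSwinnertonDyer.Rank1Residual.SmallImageMu

/-- **The graded discrete core (odd prime; OPEN for `n ≥ 1`, nothing asserted).**  At a good ordinary
`p ≠ 2` with `Irr`, `¬Surj`, cyclotomic `κ` with topological generator `γ`: if some genuine `Λ`-adic
Euler-system class `s` of the pinned `𝐇¹` has Euler loss `≤ n` (`s ∉ p^{n+1}𝐇¹`), then some power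
`(conj_γ − id)^J` kills every `y ∈ H¹(ℚ_∞, E[p])` whose image in `H¹(ℚ_∞, E[p^∞])` lies in
`p^n · Sel₀(ℚ_∞, E[p^∞])`.  The `n = 0` slice is `X10.CoreTheoremAOddPrime` (kernel theorem
`X10.coreTheoremAOddPrime_holds`); the `n ≥ 1` slices are the planner's graded-core blueprint over
`A = Λ/(p^{n+1}, ω²)` (MEMO-es §15/§21: stubs S1 key formula over `A`, S2 Chebotarev at `p`-level `n+1`,
S4 `X`-side test class; S3 settled), i.e. the exact statement a port of
`CoreAssembly.coreOdd_of_selmerDual_of_stepsTwoFour` to `A` must conclude.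
[cite: Kato2004Asterisque, Thm. 13.4 (p. 226) and §13.8 — shape only; OPEN at `𝔭 = (p)` for `n ≥ 1`]
[cite: MazurRubin2004, Thm. 5.3.10 and p. 67 («`𝔓_N = (U^N + p)`», with `τ`) — shape only] -/
@[conjecture] def FineCoreGradedOddPrime : Prop :=
  ∀ (W : WeierstrassCurve ℚ) [W.IsElliptic] [W.IsGloballyMinimal] (p : ℕ) [Fact p.Prime]
    [ContinuousSMul ℤ_[p] (W.tateModule p)] [Module.Free ℤ_[p] (W.tateModule p)]
    [Module.Finite ℤ_[p] (W.tateModule p)]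
    (κ : ZpExtension ℚ p) (γ : absoluteGaloisGroup ℚ) (I : IwasawaH1Data W p κ γ) (n : ℕ),
    p ≠ 2 → W.HasGoodReductionAtPrime p → ¬ (p : ℤ) ∣ W.frobeniusTrace p →
    W.HasIrreducibleModPGaloisRep p → ¬ W.HasSurjectiveModNGaloisRep p →
    κ.IsCyclotomic → κ.IsTopGenerator γ →
    (∃ s : I.H, IsEulerSystemClass W p κ γ I s ∧
      s ∉ (IwasawaAlgebra.augIdealP p ^ (n + 1)) • (⊤ : Submodule (IwasawaAlgebra p) I.H)) →
    ∃ J : ℕ, ∀ y : Literature.NumberTheory.EllipticCurves.subgroupH1 κ.kerSubgroup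
        (WeierstrassCurve.geomTorsion W (p : ℤ)),
      (∃ t : W.fineSelmerInfty κ,
        W.torsionToPrimaryH1Sub p κ.kerSubgroup y = p ^ n • (t : W.subgroupH1 p κ.kerSubgroup)) →
        (⇑(Literature.NumberTheory.EllipticCurves.conjH1 κ.kerSubgroup
            (WeierstrassCurve.geomTorsion W (p : ℤ)) γ -
          AddMonoidHom.id (Literature.NumberTheory.EllipticCurves.subgroupH1 κ.kerSubgroup
            (WeierstrassCurve.geomTorsion W (p : ℤ)))))^[J] y = 0

/-- **The `n = 0` slice of the graded core is the odd-prime core** (`p^0 · Sel₀ = Sel₀`, `(p)^1 = (p)`):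
`FineCoreGradedOddPrime ⟹ X10.CoreTheoremAOddPrime`. [cite: Kato2004Asterisque, Thm. 12.6 (p. 222) (shape only)] -/
theorem core_of_fineCoreGraded (h : FineCoreGradedOddPrime) : X10.CoreTheoremAOddPrime := by
  intro W _ _ p _ _ _ _ κ γ I hp2 hgood hap hirr hns hκ hγ hs
  obtain ⟨s, hs, hsp⟩ := hs
  obtain ⟨J, hJ⟩ := h W p κ γ I 0 hp2 hgood hap hirr hns hκ hγ ⟨s, hs, by rwa [zero_add, pow_one]⟩
  refine ⟨J, fun y hy ↦ hJ y ⟨⟨_, hy⟩, by rw [pow_zero, one_smul]⟩⟩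

/-- **The `n = 0` slice of the graded core is a THEOREM** (the kernel `X10.coreTheoremAOddPrime_holds`):
the graded statement at `n = 0`, verbatim. [cite: Kato2004Asterisque, Thm. 12.6 (p. 222) and §13.8 (shape)] -/
theorem fineCoreGraded_zero :
    ∀ (W : WeierstrassCurve ℚ) [W.IsElliptic] [W.IsGloballyMinimal] (p : ℕ) [Fact p.Prime]
      [ContinuousSMul ℤ_[p] (W.tateModule p)] [Module.Free ℤ_[p] (W.tateModule p)]
      [Module.Finite ℤ_[p] (W.tateModule p)]
      (κ : ZpExtension ℚ p) (γ : absoluteGaloisGroup ℚ) (I : IwasawaH1Data W p κ γ),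
      p ≠ 2 → W.HasGoodReductionAtPrime p → ¬ (p : ℤ) ∣ W.frobeniusTrace p →
      W.HasIrreducibleModPGaloisRep p → ¬ W.HasSurjectiveModNGaloisRep p →
      κ.IsCyclotomic → κ.IsTopGenerator γ →
      (∃ s : I.H, IsEulerSystemClass W p κ γ I s ∧
        s ∉ (IwasawaAlgebra.augIdealP p ^ (0 + 1)) • (⊤ : Submodule (IwasawaAlgebra p) I.H)) →
      ∃ J : ℕ, ∀ y : Literature.NumberTheory.EllipticCurves.subgroupH1 κ.kerSubgroup
          (WeierstrassCurve.geomTorsion W (p : ℤ)),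
        (∃ t : W.fineSelmerInfty κ,
          W.torsionToPrimaryH1Sub p κ.kerSubgroup y = p ^ 0 • (t : W.subgroupH1 p κ.kerSubgroup)) →
          (⇑(Literature.NumberTheory.EllipticCurves.conjH1 κ.kerSubgroup
              (WeierstrassCurve.geomTorsion W (p : ℤ)) γ -
            AddMonoidHom.id (Literature.NumberTheory.EllipticCurves.subgroupH1 κ.kerSubgroup
              (WeierstrassCurve.geomTorsion W (p : ℤ)))))^[J] y = 0 := by
  intro W _ _ p _ _ _ _ κ γ I hp2 hgood hap hirr hns hκ hγ hs
  obtain ⟨s, hs, hsp⟩ := hs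
  obtain ⟨J, hJ⟩ := X10.coreTheoremAOddPrime_holds W p κ γ I hp2 hgood hap hirr hns hκ hγ
    ⟨s, hs, by rwa [zero_add, pow_one] at hsp⟩
  refine ⟨J, fun y hy ↦ hJ y ?_⟩
  obtain ⟨t, ht⟩ := hy
  rw [ht, pow_zero, one_smul]
  exact t.2

/-- **Pointwise conversion (any number field, any `ℤ_p`-extension, any dual fine Selmer datum): if
`(conj_γ − id)^J` kills every `E[p]`-class whose image lies in `p^n · Sel₀(K_∞, E[p^∞])`, then
`μ(p^n · X₀) = 0`.**  Graded reduction ⟹ `(p^n Sel₀)[p]` finite ⟹ (graded Pontryagin duality)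
`p^n X₀ / p^{n+1} X₀` finite; `X₀` is finitely generated (`FineSelmerDualData.module_finite`, proved), so
is `p^n X₀` (`Λ` Noetherian); hence `length_{(p)}(p^n X₀) = 0`
(`KatoMuSkeleton.lengthAt_eq_zero_of_finite_quotient_p`) and `μ(p^n X₀) = 0`
(`muInvariant_eq_toNat_lengthAt`).  The `n = 0` case is the conversion inside
`X10.mu_eq_zero_of_coreOddPrime`. [cite: GreenbergLNM1716, §1 p. 60 (after Conj. 1.3)] [cite: Washington1997, §13.2] -/
theorem muInvariant_pPow_eq_zero_of_forall_iterate_eq_zero {K : Type} [Field K] [NumberField K]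
    {W : WeierstrassCurve K} [W.IsElliptic] {p : ℕ} [Fact p.Prime] {κ : ZpExtension K p}
    {γ : absoluteGaloisGroup K} (hγ : κ.IsTopGenerator γ) (Y : W.FineSelmerDualData κ γ) {J n : ℕ}
    (hJ : ∀ y : Literature.NumberTheory.EllipticCurves.subgroupH1 κ.kerSubgroup (geomTorsion W (p : ℤ)),
      (∃ t : W.fineSelmerInfty κ,
        W.torsionToPrimaryH1Sub p κ.kerSubgroup y = p ^ n • (t : W.subgroupH1 p κ.kerSubgroup)) →
        (⇑(Literature.NumberTheory.EllipticCurves.conjH1 κ.kerSubgroup (geomTorsion W (p : ℤ)) γ -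
            AddMonoidHom.id (Literature.NumberTheory.EllipticCurves.subgroupH1 κ.kerSubgroup
              (geomTorsion W (p : ℤ)))))^[J] y = 0) :
    muInvariant p ↥((IwasawaAlgebra.augIdealP p ^ n) • (⊤ : Submodule (IwasawaAlgebra p) Y.X)) = 0 := by
  have hfin := W.finite_fineSelmerInfty_gradedPTorsion_of_forall_iterate_eq_zero (κ := κ) hγ hJ
  haveI hYfg : Module.Finite (IwasawaAlgebra p) Y.X :=
    WeierstrassCurve.FineSelmerDualData.module_finite W κ hγ Y
  set N : Submodule (IwasawaAlgebra p) Y.X :=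
    (IwasawaAlgebra.augIdealP p ^ n) • (⊤ : Submodule (IwasawaAlgebra p) Y.X) with hN
  haveI : IsNoetherian (IwasawaAlgebra p) Y.X := isNoetherian_of_isNoetherianRing_of_finite _ _
  haveI : Module.Finite (IwasawaAlgebra p) ↥N := Module.Finite.of_injective N.subtype N.injective_subtype
  haveI : Finite (↥N ⧸ (IwasawaAlgebra.augIdealP p • (⊤ : Submodule (IwasawaAlgebra p) ↥N))) :=
    Y.finite_gradedQuotient_of_finite_gradedPTorsion n hfin
  let 𝔭 : PrimeSpectrum (IwasawaAlgebra p) :=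
    ⟨IwasawaAlgebra.augIdealP p, IwasawaAlgebra.isPrime_augIdealP_holds p⟩
  have h0 : Module.lengthAt (IwasawaAlgebra p) ↥N 𝔭 = 0 :=
    KatoMuSkeleton.lengthAt_eq_zero_of_finite_quotient_p (M := ↥N) 𝔭 rfl
  rw [muInvariant_eq_toNat_lengthAt p (↥N) 𝔭 rfl, h0]
  rfl

/-- **KERNEL LINK: the graded discrete core ⟹ ES-C4** (`SIM.FineExponentLeEulerLossOnClassX9`, by name):
`ClassX9 ⟹ 5 ≤ p ≠ 2`, good ordinary, `Irr`, `¬Surj`; the core gives `J`; then the pointwise conversion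
`muInvariant_pPow_eq_zero_of_forall_iterate_eq_zero`. [cite: GreenbergLNM1716, §1 p. 60 (after Conj. 1.3)]
[cite: Washington1997, §13.2] -/
theorem fineExponentLeEulerLossOnClassX9_of_fineCoreGraded (h : FineCoreGradedOddPrime) :
    SmallImageMu.FineExponentLeEulerLossOnClassX9 := by
  intro W _ _ p _ _ _ _ κ γ I n hX9 hκ hγ _hγ' hs Y
  obtain ⟨-, h5, hgood, hap, hirr, hns⟩ := hX9
  obtain ⟨J, hJ⟩ := h W p κ γ I n (by omega) hgood hap hirr hns hκ hγ hs
  exact muInvariant_pPow_eq_zero_of_forall_iterate_eq_zero hγ Y hJ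

/-- **The `n = 0` slice of ES-C4 is a THEOREM through the discrete route** (`fineCoreGraded_zero` +
`muInvariant_pPow_eq_zero_of_forall_iterate_eq_zero`): at every X9 pair, an Euler-system class
`s ∉ p𝐇¹` forces `μ(p^0 · X₀) = μ(X₀) = 0` — the statement of the leaf at `n = 0`, verbatim (second proof
of the cell's `fineExponentLeEulerLoss_zero`, HOME/es/Sketch4.lean, which went through the F1 identity).
[cite: Kato2004Asterisque, Thm. 12.6 (p. 222) and §13.8 (shape)] [cite: GreenbergLNM1716, §1 p. 60] -/
theorem fineExponentLeEulerLossOnClassX9_zero :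
    ∀ (W : WeierstrassCurve ℚ) [W.IsElliptic] [W.IsGloballyMinimal] (p : ℕ) [Fact p.Prime]
      [ContinuousSMul ℤ_[p] (W.tateModule p)] [Module.Free ℤ_[p] (W.tateModule p)]
      [Module.Finite ℤ_[p] (W.tateModule p)]
      (κ : ZpExtension ℚ p) (γ : absoluteGaloisGroup ℚ) (I : IwasawaH1Data W p κ γ),
      ClassX9 W p → κ.IsCyclotomic → κ.IsTopGenerator γ → IsCyclotomicVariable p γ →
      (∃ s : I.H, IsEulerSystemClass W p κ γ I s ∧
        s ∉ (IwasawaAlgebra.augIdealP p ^ (0 + 1)) • (⊤ : Submodule (IwasawaAlgebra p) I.H)) →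
      ∀ Y : W.FineSelmerDualData κ γ,
        muInvariant p ↥((IwasawaAlgebra.augIdealP p ^ 0) • (⊤ : Submodule (IwasawaAlgebra p) Y.X)) = 0 := by
  intro W _ _ p _ _ _ _ κ γ I hX9 hκ hγ _hγ' hs Y
  obtain ⟨-, h5, hgood, hap, hirr, hns⟩ := hX9
  obtain ⟨J, hJ⟩ := fineCoreGraded_zero W p κ γ I (by omega) hgood hap hirr hns hκ hγ hs
  exact muInvariant_pPow_eq_zero_of_forall_iterate_eq_zero hγ Y hJ

end Summit.BirchSwinnertonDyer.Rank1Residual.SmallImageMu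

end
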